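import Summits.Ventures.PercRepro.ProfilePointedCircuitClassesInOutFiveGirth

/-!
# PercRepro — THE GIRTH REGIME OF THE WHOLE PER-SET FAMILY `(A_S)` AT THE BOTTOM OF NULLITY `5`:
`thru_5(S) ≤ thru_{n−6}(S)` FOR EVERY `S` WITH `#S ≤ 5` ON EVERY MATROID OF NULLITY `5` WHOSE `(ρ − 1)`-SUBSETS ARE
INDEPENDENT (p5, gen 43; `proofs/P5-GM1.md` §65(l))

The per-set refinement `(A_S)` of Theorem A's step at the bottom of nullity `5` (§53(b), §63(a): `InOutBottomFive`
is `#S = 1`, `InOutPairBottomFive` is `#S = 2`) reads `thru_5(S) ≤ thru_{n−6}(S)` on `#E = ρ + 5`; by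
complementation `thru_{n−6}(S)` counts the bi-independent `6`-sets DISJOINT from `S` (`thruCount_sub_eq_card_filter`).
In the girth regime of ProfilePointedCircuitClassesInOutFiveGirth (every `(ρ − 1)`-subset of `E` independent) the
disjointness relation between the demands (bi-independent `5`-sets `W ⊇ S`) and the units (bi-independent `6`-sets
`U` with `U ∩ S = ∅`) has every demand with `C(ρ, 6)` units (`B ∖ Y`, `Y` a `(ρ − 6)`-subset of the basis complement
`B`) and every unit with at most `C(ρ − 1 − #S, 5 − #S) ≤ C(ρ, 6)` demands (`W ∖ S` is a `(5 − #S)`-subset of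
`(E ∖ U) ∖ S`), so `#𝒟 ≤ #𝒰` (`thruCount_five_le_thruCount_of_girth`).  For `#S = 2` this is the pair statement
`InOutPairBottomFive` of §63(a) in the girth regime at every `ρ ≥ 7` (§64 had it at `n = 12` without hypothesis).
-/

open scoped Matroid

namespace PercRepro.Cogirth

open Finset ThmH Skew Shadow Profile

variable {α : Type} [DecidableEq α] {N : Matroid α} [N.Finite]

section ThruFiveGirth

/-- **COMPLEMENTATION**: the bi-independent `(n − k)`-sets containing `S` are the complements of the bi-independent
`k`-sets disjoint from `S`: `thru_{n−k}(S) = #{X ∈ BI_k : X ∩ S = ∅}`. -/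
theorem thruCount_sub_eq_card_filter (k : ℕ) (hk : k ≤ (gr N).card) {S : Finset α} (hS : S ⊆ gr N) :
    thruCount N ((gr N).card - k) S = ((biIndepSets N k).filter (fun X => X ∩ S = ∅)).card := by
  unfold thruCount
  apply card_nbij' (fun X => gr N \ X) (fun X => gr N \ X)
  · intro X hX
    rw [mem_coe, mem_filter, mem_biIndepSets] at hX
    obtain ⟨⟨hXg, hXc, hXr, hXcr⟩, hSX⟩ := hX
    rw [mem_coe, mem_filter, mem_biIndepSets]
    refine ⟨⟨sdiff_subset, by rw [card_sdiff_of_subset hXg, hXc]; omega, hXcr, ?_⟩, ?_⟩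
    · rw [Finset.sdiff_sdiff_eq_self hXg]; exact hXr
    · rw [← disjoint_iff_inter_eq_empty, disjoint_left]
      intro x hx hxS
      exact (mem_sdiff.1 hx).2 (hSX hxS)
  · intro X hX
    rw [mem_coe, mem_filter, mem_biIndepSets] at hX
    obtain ⟨⟨hXg, hXc, hXr, hXcr⟩, hXS⟩ := hX
    rw [mem_coe, mem_filter, mem_biIndepSets]
    refine ⟨⟨sdiff_subset, by rw [card_sdiff_of_subset hXg, hXc], hXcr, ?_⟩, ?_⟩
    · rw [Finset.sdiff_sdiff_eq_self hXg]; exact hXr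
    · intro s hs
      rw [mem_sdiff]
      refine ⟨hS hs, fun hsX => ?_⟩
      have : s ∈ X ∩ S := mem_inter.2 ⟨hsX, hs⟩
      rw [hXS] at this
      exact notMem_empty s this
  · intro X hX
    rw [mem_coe, mem_filter, mem_biIndepSets] at hX
    exact Finset.sdiff_sdiff_eq_self hX.1.1
  · intro X hX
    rw [mem_coe, mem_filter, mem_biIndepSets] at hX
    exact Finset.sdiff_sdiff_eq_self hX.1.1

/-- **THE UNITS' SIDE**: on `#E = ρ + 5`, a bi-independent `6`-set `U` disjoint from `S` has at most
`C(ρ − 1 − #S, 5 − #S)` bi-independent `5`-sets `W ⊇ S` disjoint from it (`W ↦ W ∖ S` is injective into the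
`(5 − #S)`-subsets of `(E ∖ U) ∖ S`). -/
theorem card_thru_demands_disjoint_le_choose (hn : (gr N).card = rk N (gr N) + 5) {S : Finset α}
    (hS : S ⊆ gr N) {U : Finset α}
    (hU : U ∈ (biIndepSets N 6).filter (fun X => X ∩ S = ∅)) :
    (((biIndepSets N 5).filter (fun X => S ⊆ X)).filter (fun W => W ∩ U = ∅)).card ≤
      (rk N (gr N) - 1 - S.card).choose (5 - S.card) := by
  rw [mem_filter, mem_biIndepSets] at hU
  obtain ⟨⟨hUg, hU6, _, _⟩, hUS⟩ := hU
  have hZ : (gr N \ U).card = rk N (gr N) - 1 := by rw [card_sdiff_of_subset hUg, hU6]; omega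
  have hSZ : S ⊆ gr N \ U := by
    intro s hs
    rw [mem_sdiff]
    refine ⟨hS hs, fun hsU => ?_⟩
    have : s ∈ U ∩ S := mem_inter.2 ⟨hsU, hs⟩
    rw [hUS] at this
    exact notMem_empty s this
  have hWZ : ∀ W ∈ ((biIndepSets N 5).filter (fun X => S ⊆ X)).filter (fun W => W ∩ U = ∅),
      W ⊆ gr N \ U := by
    intro W hW
    rw [mem_filter, mem_filter, mem_biIndepSets] at hW
    obtain ⟨⟨⟨hWg, _, _, _⟩, _⟩, hWU⟩ := hW
    intro w hw
    rw [mem_sdiff]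
    refine ⟨hWg hw, fun hwU => ?_⟩
    have : w ∈ W ∩ U := mem_inter.2 ⟨hw, hwU⟩
    rw [hWU] at this
    exact notMem_empty w this
  calc _ ≤ (((gr N \ U) \ S).powersetCard (5 - S.card)).card := by
        apply card_le_card_of_injOn (fun W => W \ S)
        · intro W hW
          rw [mem_coe] at hW
          have hWZ' := hWZ W hW
          rw [mem_filter, mem_filter, mem_biIndepSets] at hW
          obtain ⟨⟨⟨_, hW5, _, _⟩, hSW⟩, _⟩ := hW
          rw [mem_coe, mem_powersetCard]
          exact ⟨sdiff_subset_sdiff hWZ' (Subset.refl _), by rw [card_sdiff_of_subset hSW, hW5]⟩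
        · intro W₁ hW₁ W₂ hW₂ h
          rw [mem_coe, mem_filter, mem_filter] at hW₁ hW₂
          have h1 : W₁ = (W₁ \ S) ∪ S := (sdiff_union_of_subset hW₁.1.2).symm
          have h2 : W₂ = (W₂ \ S) ∪ S := (sdiff_union_of_subset hW₂.1.2).symm
          simp only at h
          rw [h1, h2, h]
    _ = (rk N (gr N) - 1 - S.card).choose (5 - S.card) := by
        rw [card_powersetCard, card_sdiff_of_subset hSZ, hZ]

/-- The unit `B ∖ Y` of a demand `W ⊇ S` and a `(ρ − 6)`-subset `Y` of its basis complement `B`, when `W ∪ Y` is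
independent: a bi-independent `6`-set disjoint from `S` and from `W`. -/
theorem sdiff_mem_thru_units_of_indep (hn : (gr N).card = rk N (gr N) + 5) (hR : 7 ≤ rk N (gr N))
    {S W : Finset α} (hW : W ∈ (biIndepSets N 5).filter (fun X => S ⊆ X)) {Y : Finset α}
    (hY : Y ∈ (gr N \ W).powersetCard (rk N (gr N) - 6)) (hind : rk N (W ∪ Y) = (W ∪ Y).card) :
    (gr N \ W) \ Y ∈ ((biIndepSets N 6).filter (fun X => X ∩ S = ∅)).filter (fun U => W ∩ U = ∅) := by
  rw [mem_filter, mem_biIndepSets] at hW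
  obtain ⟨⟨hWg, hW5, _, hWc⟩, hSW⟩ := hW
  rw [mem_powersetCard] at hY
  obtain ⟨hYB, hYc⟩ := hY
  have hB : (gr N \ W).card = rk N (gr N) := by rw [card_sdiff_of_subset hWg, hn, hW5]; omega
  have hcompl : gr N \ ((gr N \ W) \ Y) = W ∪ Y := by
    ext x
    simp only [mem_sdiff, mem_union, not_and, not_not]
    constructor
    · rintro ⟨hxg, h⟩
      by_cases hxW : x ∈ W
      · exact Or.inl hxW
      · exact Or.inr (h ⟨hxg, hxW⟩)
    · rintro (hxW | hxY)
      · exact ⟨hWg hxW, fun h => absurd hxW h.2⟩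
      · exact ⟨(mem_sdiff.1 (hYB hxY)).1, fun _ => hxY⟩
  have hdisjW : W ∩ ((gr N \ W) \ Y) = ∅ := by
    ext x
    simp only [mem_inter, mem_sdiff, notMem_empty, iff_false, not_and, not_not]
    intro hxW hxB
    exact absurd hxW hxB.2
  rw [mem_filter, mem_filter, mem_biIndepSets]
  refine ⟨⟨⟨sdiff_subset.trans sdiff_subset, ?_, ?_, ?_⟩, ?_⟩, hdisjW⟩
  · rw [card_sdiff_of_subset hYB, hB, hYc]; omega
  · exact rk_eq_card_of_subset_of_rk_eq_card sdiff_subset (by rw [hWc])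
  · rw [hcompl, hind]
  · rw [← disjoint_iff_inter_eq_empty, disjoint_left]
    intro x hx hxS
    have : x ∈ W ∩ ((gr N \ W) \ Y) := mem_inter.2 ⟨hSW hxS, hx⟩
    rw [hdisjW] at this
    exact notMem_empty x this

/-- **THE DEMANDS' SIDE IN THE GIRTH REGIME**: a bi-independent `5`-set `W ⊇ S` has at least `C(ρ, ρ − 6)`
bi-independent `6`-sets disjoint from `S` and from it. -/
theorem choose_le_card_thru_units_of_girth (hn : (gr N).card = rk N (gr N) + 5) (hR : 7 ≤ rk N (gr N))
    (hg : ∀ X ⊆ gr N, X.card = rk N (gr N) - 1 → rk N X = X.card) {S W : Finset α}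
    (hW : W ∈ (biIndepSets N 5).filter (fun X => S ⊆ X)) :
    (rk N (gr N)).choose (rk N (gr N) - 6) ≤
      (((biIndepSets N 6).filter (fun X => X ∩ S = ∅)).filter (fun U => W ∩ U = ∅)).card := by
  have hW' := hW
  rw [mem_filter, mem_biIndepSets] at hW'
  obtain ⟨⟨hWg, hW5, _, _⟩, _⟩ := hW'
  have hB : (gr N \ W).card = rk N (gr N) := by rw [card_sdiff_of_subset hWg, hn, hW5]; omega
  calc (rk N (gr N)).choose (rk N (gr N) - 6)
      = ((gr N \ W).powersetCard (rk N (gr N) - 6)).card := by rw [card_powersetCard, hB]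
    _ = (((gr N \ W).powersetCard (rk N (gr N) - 6)).image (fun Y => (gr N \ W) \ Y)).card := by
        rw [card_image_of_injOn]
        intro Y hY Y' hY' h
        rw [mem_coe, mem_powersetCard] at hY hY'
        have h' : (gr N \ W) \ Y = (gr N \ W) \ Y' := h
        have e1 := Finset.sdiff_sdiff_eq_self hY.1
        have e2 := Finset.sdiff_sdiff_eq_self hY'.1
        rw [← e1, ← e2, h']
    _ ≤ _ := by
        apply card_le_card
        intro U hU
        rw [mem_image] at hU
        obtain ⟨Y, hY, rfl⟩ := hU
        have hind : rk N (W ∪ Y) = (W ∪ Y).card := by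
          rw [mem_powersetCard] at hY
          apply hg
          · exact union_subset hWg (hY.1.trans sdiff_subset)
          · rw [card_union_of_disjoint, hW5, hY.2]
            · omega
            · rw [disjoint_left]
              intro x hxW hxY
              exact (mem_sdiff.1 (hY.1 hxY)).2 hxW
        exact sdiff_mem_thru_units_of_indep hn hR hW hY hind

/-- `C(ρ − 1 − s, 5 − s) ≤ C(ρ, 6)` for `s ≤ 5 ≤ ρ`: Pascal's rule `C(n, k) ≥ C(n − 1, k − 1)` iterated. -/
theorem choose_sub_le_choose_six {ρ s : ℕ} (hs : s ≤ 5) (hρ : 6 ≤ ρ) :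
    (ρ - 1 - s).choose (5 - s) ≤ ρ.choose 6 := by
  have step : ∀ n k : ℕ, 1 ≤ n → 1 ≤ k → (n - 1).choose (k - 1) ≤ n.choose k := by
    intro n k hn hk
    obtain ⟨n', rfl⟩ : ∃ n', n = n' + 1 := ⟨n - 1, by omega⟩
    obtain ⟨k', rfl⟩ : ∃ k', k = k' + 1 := ⟨k - 1, by omega⟩
    rw [Nat.add_sub_cancel, Nat.add_sub_cancel, Nat.choose_succ_succ]
    omega
  interval_cases s
  · exact step ρ 6 (by omega) (by omega)
  · calc (ρ - 1 - 1).choose 4 ≤ (ρ - 1).choose 5 := by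
          have := step (ρ - 1) 5 (by omega) (by omega); simpa using this
      _ ≤ ρ.choose 6 := step ρ 6 (by omega) (by omega)
  · calc (ρ - 1 - 2).choose 3 ≤ (ρ - 2).choose 4 := by
          have := step (ρ - 2) 4 (by omega) (by omega)
          have e : ρ - 1 - 2 = ρ - 2 - 1 := by omega
          rw [e]; exact this
      _ ≤ (ρ - 1).choose 5 := by
          have := step (ρ - 1) 5 (by omega) (by omega)
          have e : ρ - 2 = ρ - 1 - 1 := by omega
          rw [e]; exact this
      _ ≤ ρ.choose 6 := step ρ 6 (by omega) (by omega)
  · calc (ρ - 1 - 3).choose 2 ≤ (ρ - 3).choose 3 := by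
          have := step (ρ - 3) 3 (by omega) (by omega)
          have e : ρ - 1 - 3 = ρ - 3 - 1 := by omega
          rw [e]; exact this
      _ ≤ (ρ - 2).choose 4 := by
          have := step (ρ - 2) 4 (by omega) (by omega)
          have e : ρ - 3 = ρ - 2 - 1 := by omega
          rw [e]; exact this
      _ ≤ (ρ - 1).choose 5 := by
          have := step (ρ - 1) 5 (by omega) (by omega)
          have e : ρ - 2 = ρ - 1 - 1 := by omega
          rw [e]; exact this
      _ ≤ ρ.choose 6 := step ρ 6 (by omega) (by omega)
  · calc (ρ - 1 - 4).choose 1 ≤ (ρ - 4).choose 2 := by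
          have := step (ρ - 4) 2 (by omega) (by omega)
          have e : ρ - 1 - 4 = ρ - 4 - 1 := by omega
          rw [e]; exact this
      _ ≤ (ρ - 3).choose 3 := by
          have := step (ρ - 3) 3 (by omega) (by omega)
          have e : ρ - 4 = ρ - 3 - 1 := by omega
          rw [e]; exact this
      _ ≤ (ρ - 2).choose 4 := by
          have := step (ρ - 2) 4 (by omega) (by omega)
          have e : ρ - 3 = ρ - 2 - 1 := by omega
          rw [e]; exact this
      _ ≤ (ρ - 1).choose 5 := by
          have := step (ρ - 1) 5 (by omega) (by omega)
          have e : ρ - 2 = ρ - 1 - 1 := by omega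
          rw [e]; exact this
      _ ≤ ρ.choose 6 := step ρ 6 (by omega) (by omega)
  · calc (ρ - 1 - 5).choose 0 = 1 := Nat.choose_zero_right _
      _ ≤ ρ.choose 6 := Nat.choose_pos (by omega)

/-- **THE GIRTH REGIME OF THE PER-SET FAMILY `(A_S)` AT THE BOTTOM OF NULLITY `5`**: on every matroid with
`#E = ρ + 5`, `ρ ≥ 7`, whose `(ρ − 1)`-subsets are all independent, `thru_5(S) ≤ thru_{n−6}(S)` for every
`S ⊆ E` with at most five points. -/
theorem thruCount_five_le_thruCount_of_girth (hn : (gr N).card = rk N (gr N) + 5) (hR : 7 ≤ rk N (gr N))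
    (hg : ∀ X ⊆ gr N, X.card = rk N (gr N) - 1 → rk N X = X.card) {S : Finset α} (hS : S ⊆ gr N)
    (hS5 : S.card ≤ 5) : thruCount N 5 S ≤ thruCount N ((gr N).card - 6) S := by
  rw [thruCount_sub_eq_card_filter 6 (by omega) hS]
  unfold thruCount
  set D := (biIndepSets N 5).filter (fun X => S ⊆ X) with hD
  set U := (biIndepSets N 6).filter (fun X => X ∩ S = ∅) with hU
  have key := Finset.sum_card_bipartiteAbove_eq_sum_card_bipartiteBelow (fun W V => W ∩ V = ∅)
    (s := D) (t := U)
  have h1 : (rk N (gr N)).choose (rk N (gr N) - 6) * D.card ≤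
      ∑ W ∈ D, (Finset.bipartiteAbove (fun W V => W ∩ V = ∅) U W).card := by
    rw [mul_comm, ← smul_eq_mul]
    apply card_nsmul_le_sum
    intro W hW
    unfold Finset.bipartiteAbove
    exact choose_le_card_thru_units_of_girth hn hR hg hW
  have h2 : ∑ V ∈ U, (Finset.bipartiteBelow (fun W V => W ∩ V = ∅) D V).card ≤
      (rk N (gr N) - 1 - S.card).choose (5 - S.card) * U.card := by
    rw [mul_comm, ← smul_eq_mul]
    apply sum_le_card_nsmul
    intro V hV
    unfold Finset.bipartiteBelow
    exact card_thru_demands_disjoint_le_choose hn hS hV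
  have hsym : (rk N (gr N)).choose (rk N (gr N) - 6) = (rk N (gr N)).choose 6 := by
    rw [Nat.choose_symm (by omega)]
  have hle := choose_sub_le_choose_six (ρ := rk N (gr N)) hS5 (by omega)
  rw [hsym] at h1
  have h3 : (rk N (gr N)).choose 6 * D.card ≤ (rk N (gr N)).choose 6 * U.card := by
    calc (rk N (gr N)).choose 6 * D.card ≤ (rk N (gr N) - 1 - S.card).choose (5 - S.card) * U.card := by
          omega
      _ ≤ (rk N (gr N)).choose 6 * U.card := Nat.mul_le_mul_right _ hle
  have hpos : 0 < (rk N (gr N)).choose 6 := Nat.choose_pos (by omega)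
  exact Nat.le_of_mul_le_mul_left h3 hpos

end ThruFiveGirth

end PercRepro.Cogirth
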